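import Mathlib.NumberTheory.NumberField.Cyclotomic.Ideal
import Mathlib.NumberTheory.NumberField.Cyclotomic.Basic
import Mathlib.NumberTheory.Cyclotomic.Gal
import Mathlib.NumberTheory.DirichletCharacter.Orthogonality
import Mathlib.NumberTheory.MulChar.Duality
import Mathlib.NumberTheory.LSeries.DirichletContinuation
import Mathlib.NumberTheory.EulerProduct.DirichletLSeries
import Mathlib.NumberTheory.RamificationInertia.Galois
import Mathlib.RingTheory.RootsOfUnity.Complex
import Mathlib.Analysis.Calculus.Deriv.Prod
import Literature.NumberTheory.LFunctions.DedekindZetaProofs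
import Literature.NumberTheory.LFunctions.GeneralizedRH
import Literature.NumberTheory.LFunctions.RHGeneralizedRH
import HarnessLib

/-!
# ERH ⇒ GRH, via `ζ_{ℚ(ζ_N)}(s) = ∏_{χ mod N} L(s, χ⋆)` (Washington Thm. 4.3)

Trunk T-ANT (topic `NumberTheory/LFunctions`). Sibling proof file of
`Literature/NumberTheory/LFunctions/RHGeneralizedRH.lean` (D-0014: the named fact
`Literature.NumberTheory.LFunctions.ExtendedRiemannHypothesis.generalizedRiemannHypothesis` — the Extended Riemann Hypothesis
for all Dedekind zeta functions implies the Generalised Riemann Hypothesis for all Dirichlet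
`L`-functions, both in strip form — stays a `def … : Prop` there; §6 of this file proves it, as
`Literature.NumberTheory.LFunctions.ExtendedRiemannHypothesis.generalizedRiemannHypothesis_holds`, together with the converse
for cyclotomic fields). The proof is the one indicated in the fact's docstring (Washington,
*Introduction to Cyclotomic Fields*, Thm. 4.3; Davenport, *Multiplicative Number Theory*,
ch. 20): a zero `s` of `L(s, χ)`, `χ` mod `N`, in the open critical strip is a zero of
`L(s, χ⋆)` (`GeneralizedRH.lean`, `DirichletCharacter.LFunction_eq_zero_iff_primitiveCharacter`),
hence of `ζ_K(s) = ∏_{χ' mod N} L(s, χ'⋆)` for `K = ℚ(ζ_N) = CyclotomicField N ℚ : Type`, and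
ERH for `K` gives `re s = 1/2`. Everything except §6 is the factorisation theorem this needs.

§§1–5 prove, for every `N ≥ 1` and every `N`-th cyclotomic extension `K/ℚ`
(`IsCyclotomicExtension {N} ℚ K`, e.g. `K = CyclotomicField N ℚ`), the classical factorisation

  `ζ_K(s) = ∏_{χ mod N} L(s, χ⋆)`,  `χ⋆` the primitive character inducing `χ`,

first as an identity of convergent Dirichlet series / Euler products on `re s > 1`
(`Literature.NumberTheory.LFunctions.dedekindZeta_eq_prod_LSeries_primitiveCharacter`, with Mathlib's
`NumberField.dedekindZeta` and `LSeries`), and then for the continued functions off `s = 1`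
(`Literature.NumberTheory.LFunctions.dedekindZetaCont_eq_cyclotomicLProduct`, with the tree's `Literature.NumberTheory.LFunctions.dedekindZetaCont` and
Mathlib's `DirichletCharacter.LFunction`). In passing it discharges Hecke's existence theorem
`Literature.exists_isDedekindZetaContinuation K` for cyclotomic `K`
(`Literature.NumberTheory.LFunctions.exists_isDedekindZetaContinuation_of_isCyclotomicExtension`), and records the consequence
used in §6: a zero of `L(s, χ)` (`χ` mod `N`) with `re s > 0`, `s ≠ 1` is a zero of `ζ_K`
(`Literature.NumberTheory.LFunctions.dedekindZetaCont_eq_zero_of_LFunction_eq_zero`).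

Sources. L. C. Washington, *Introduction to Cyclotomic Fields*, GTM 83, Thm. 4.3 (for the
field `K` of a group `X` of Dirichlet characters, `ζ_K(s) = ∏_{χ ∈ X} L(s, χ)`; here `X` = all
characters mod `N`, `K = ℚ(ζ_N)`; the book is not held by the literature store, acquisition
requested); A. Fröhlich, M. J. Taylor, *Algebraic Number Theory*, CUP 1991 (held), Ch. VIII §3
Theorem 65 (a) (`∏_{χ ∈ Θ̃_K} L(x, χ) = ζ_K(x)`, `x > 1`) and its printed proof via Ch. VI §2
Theorem 47 (`∏_{ν ∈ Θ̃_K} (T − ν(p)) = T^{fg(e−1)} (T^f − 1)^g`), eq. (3.4), and the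
decomposition law Ch. VI §1 (1.12), (1.15). Fröhlich–Taylor state Thm. 65 for a real variable
`x > 1`; the same proof gives `re s > 1`, which is the form proved here.

## Proof architecture (Fröhlich–Taylor, proof of Thm. 65 (a))

Both sides are absolutely convergent Euler products for `re s > 1` —
`ζ_K(s) = ∏_𝔭 (1 − N𝔭^{-s})⁻¹` (`Literature.NumberTheory.LFunctions.hasProd_dedekindEulerFactor_holds`, Neukirch VII (5.2),
proved in `DedekindZetaProofs`) and `L(s, χ⋆) = ∏_p (1 − χ⋆(p) p^{-s})⁻¹` (Mathlib
`DirichletCharacter.LSeries_eulerProduct_hasProd`) — so it suffices that the factors belonging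
to each rational prime `p` coincide (F–T eq. (3.4)), after regrouping the product over the
primes `𝔭` of `K` along the prime below (`Literature.NumberTheory.LFunctions.primeBelow`, Mathlib `HasProd.sigma`). Write
`N = p^a m`, `p ∤ m`, and let `f` be the order of `p` mod `m`.

* Dedekind side (§3): every `𝔭 | p` has `N𝔭 = p^f` and there are `g` of them, `f g = φ(m)`
  (F–T VI §1 (1.12), (1.15)): Mathlib's decomposition law in `ℚ(ζ_N)`
  (`IsCyclotomicExtension.Rat.inertiaDeg_eq`, `ramificationIdx_eq`: `e = φ(p^a)`) and the
  fundamental identity `e f g = φ(N)`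
  (`Ideal.ncard_primesOver_mul_ramificationIdxIn_mul_inertiaDegIn`). Hence
  `∏_{𝔭 | p} (1 − N𝔭^{-s})⁻¹ = (1 − p^{-fs})^{-g}`.
* Character side (§§1–2): `χ⋆(p) ≠ 0` iff `p ∤ cond χ` iff `χ` is lifted from a character
  `ψ` mod `m`, and then `χ⋆(p) = ψ(p)` (Mathlib `primitiveCharacter_changeLevel_apply`,
  `primitiveCharacter_apply_of_isCoprime`); and the *character product lemma*
  `∏_{ψ mod m} (1 − ψ(p) T) = (1 − T^f)^{φ(m)/f}` (§1: `ψ ↦ ψ(p)` is a homomorphism onto the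
  `f`-th roots of unity with fibres of size `#{ψ | ψ(p) = 1} = [(ℤ/m)ˣ : ⟨p⟩] = φ(m)/f`, by
  duality for finite abelian groups, Mathlib `MulChar.card_subgroupOrderIsoSubgroupMulChar`;
  and `∏_{ζ^f = 1} (1 − ζ T) = 1 − T^f`). Hence
  `∏_χ (1 − χ⋆(p) p^{-s})⁻¹ = (1 − p^{-fs})^{-g}`.

The continuation statements (§5) then follow from Mathlib's analytic continuation of Dirichlet
`L`-functions and the uniqueness of the continuation of `ζ_K`
(`Literature.NumberTheory.LFunctions.IsDedekindZetaContinuation.eqOn_dedekindZetaCont_holds`).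

## Mathlib / tree search

Mathlib (this pin) has the decomposition of primes in `ℚ(ζ_n)`
(`Mathlib/NumberTheory/NumberField/Cyclotomic/Ideal.lean`), duality for `MulChar`
(`Mathlib/NumberTheory/MulChar/Duality.lean`), conductors and primitive characters with
`factorsThrough_gcd`, `conductor_changeLevel` (`DirichletCharacter/Basic.lean`), and the Galois
correspondence for `ℚ(ζ_n)` following Washington (`Cyclotomic/Galois.lean`), but no Dedekind
zeta factorisation (searched `dedekindZeta`, `LFunction` with `yclotomic`, `primesOver` with
`LSeries`). The tree has `ζ_K` only through `DedekindZeta(Proofs).lean`.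

## Design notes

* Declarations `DirichletCharacter.evalUnitHom`, `.prod_one_sub_apply_mul`,
  `.prod_primitiveCharacter_apply_prime_eq`, `.prod_inv_one_sub_primitiveCharacter_mul`,
  `.orderOf_cast_ordCompl_pos` are *deliberate dot-notation extensions* of Mathlib's
  `DirichletCharacter` namespace (as in `GeneralizedRH.lean`); everything else is in `Literature`.
* The prime-to-`p` part of `N` is written `N / p ^ N.factorization p`, as in Mathlib's
  `DirichletCharacter.subgroupOfPrimitiveMapToOne`.
* Primes of `K` above `p` are the fibre `{v : HeightOneSpectrum (𝓞 K) // primeBelow v = p}` of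
  `Literature.NumberTheory.LFunctions.primeBelow` (so that `Equiv.sigmaFiberEquiv` regroups the Euler product); it is identified
  with Mathlib's `primesOver (p) (𝓞 K)` by `Literature.NumberTheory.LFunctions.fiberPrimeBelowEquiv`, whence its `Fintype`
  instance. The `IsPrime`/`LiesOver` facts for fibre elements are local instances only.
* `Literature.cyclotomicLProduct N s = ∏_{χ mod N} L(s, χ⋆)` supplies the `NeZero χ.conductor`
  instance needed by `DirichletCharacter.LFunction` inline, exactly as
  `DirichletCharacter.LFunction_eq_zero_iff_primitiveCharacter` (`GeneralizedRH.lean`) does.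

## References

* L. C. Washington, *Introduction to Cyclotomic Fields*, 2nd ed., GTM 83, Springer 1997,
  Ch. 3–4, Thm. 4.3. [Washington1997]
* A. Fröhlich, M. J. Taylor, *Algebraic Number Theory*, Cambridge Studies in Advanced
  Mathematics 27, CUP 1991: Ch. VI §1 (1.12), (1.15) (pp. 188–189); Ch. VI §2, (2.12) and
  Theorem 47 (p. 198); Ch. VIII §3, Theorem 65 and eq. (3.4) (pp. 258–259). [FrohlichTaylor1990]
* J. Neukirch, *Algebraic Number Theory*, Springer 1999, Ch. I §8, Ch. VII (5.2).
  [NeukirchANT1999]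
* H. Davenport, *Multiplicative Number Theory*, 2nd ed., GTM 74, Springer 1980, ch. 5
  (imprimitive `L`-functions), ch. 20 (GRH). [DavenportMNT1980]
-/

noncomputable section

open Finset NumberField IsDedekindDomain Ideal

/-! ## 1. The character product lemma -/

namespace DirichletCharacter

variable {m : ℕ} [NeZero m]

/-- Evaluation of Dirichlet characters mod `m` at a unit `u`, as a group homomorphism to `ℂˣ`.
[folklore] -/
def evalUnitHom (u : (ZMod m)ˣ) : DirichletCharacter ℂ m →* ℂˣ :=
  (MonoidHom.eval u).comp MulChar.mulEquivToUnitHom.toMonoidHom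

omit [NeZero m] in
/-- `evalUnitHom u χ = χ(u)`. [folklore] -/
lemma coe_evalUnitHom (u : (ZMod m)ˣ) (χ : DirichletCharacter ℂ m) :
    (evalUnitHom u χ : ℂ) = χ u := by
  simp [evalUnitHom, MulChar.mulEquivToUnitHom_apply, MulChar.coe_equivToUnitHom]

omit [NeZero m] in
/-- `evalUnitHom u χ = 1 ↔ χ(u) = 1`. [folklore] -/
lemma evalUnitHom_eq_one_iff (u : (ZMod m)ˣ) (χ : DirichletCharacter ℂ m) :
    evalUnitHom u χ = 1 ↔ χ u = 1 := by
  rw [Units.ext_iff, coe_evalUnitHom, Units.val_one]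

/-- `#{χ mod m | χ(u) = 1} · ord(u) = φ(m)`: the characters trivial on `u` form the dual of the
cyclic subgroup `⟨u⟩ ≤ (ℤ/m)ˣ`, of order `[(ℤ/m)ˣ : ⟨u⟩]` (duality for finite abelian groups,
Mathlib `MulChar.card_subgroupOrderIsoSubgroupMulChar`; Fröhlich–Taylor, Appendix A (A11) as used
in the proof of Thm. 47). [folklore] -/
lemma card_filter_apply_eq_one_mul_orderOf (u : (ZMod m)ˣ) :
    #{χ : DirichletCharacter ℂ m | χ u = 1} * orderOf u = m.totient := by
  classical
  set X := OrderDual.ofDual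
    (MulChar.subgroupOrderIsoSubgroupMulChar (ZMod m) ℂ (Subgroup.zpowers u)) with hX
  have hmem : ∀ χ : DirichletCharacter ℂ m, χ ∈ X ↔ χ u = 1 := by
    intro χ
    rw [hX, MulChar.mem_subgroupOrderIsoSubgroupMulChar_iff]
    constructor
    · intro h
      exact h u (Subgroup.mem_zpowers u)
    · intro h x hx
      have hle : Subgroup.zpowers u ≤ (MulChar.toUnitHom χ).ker := by
        rw [Subgroup.zpowers_le, MonoidHom.mem_ker, Units.ext_iff, MulChar.coe_toUnitHom]
        exact h
      have hx' := hle hx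
      rw [MonoidHom.mem_ker, Units.ext_iff, MulChar.coe_toUnitHom] at hx'
      exact hx'
  have hcard : Nat.card X = Nat.card ((ZMod m)ˣ ⧸ Subgroup.zpowers u) :=
    MulChar.card_subgroupOrderIsoSubgroupMulChar
  have h1 : Nat.card X = #{χ : DirichletCharacter ℂ m | χ u = 1} := by
    rw [Nat.card_congr (Equiv.subtypeEquivRight hmem :
        X ≃ {χ : DirichletCharacter ℂ m // χ u = 1}),
      Nat.card_eq_fintype_card, Fintype.card_subtype]
  have h2 : Nat.card ((ZMod m)ˣ ⧸ Subgroup.zpowers u) * orderOf u = m.totient := by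
    rw [← Nat.card_zpowers u, ← Subgroup.index, Subgroup.index_mul_card,
      Nat.card_eq_fintype_card, ZMod.card_units_eq_totient]
  rw [← h1, hcard, h2]

/-- **Character product lemma.** For a unit `u` mod `m` of order `f` and `T : ℂ`,
`∏_{χ mod m} (1 - χ(u) T) = (1 - T^f)^{φ(m)/f}`: the map `χ ↦ χ(u)` is a homomorphism onto the
`f`-th roots of unity whose fibres all have `#{χ | χ(u) = 1} = φ(m)/f` elements, and
`∏_{ζ^f = 1} (1 - ζ T) = 1 - T^f`. (Fröhlich–Taylor, *Algebraic Number Theory*, proof of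
Thm. 47, p. 198: "each `f`th root of unity is taken equally often as a value of `ψ'(p, M/ℚ)`",
whence `∏_ν (T − ν(p)) = ∏_{ζ^f = 1} (T − ζ)^g = (T^f − 1)^g`; Washington, proof of Thm. 4.3.)
[cite: FrohlichTaylor1990, Ch. VI §2, Theorem 47 (proof)] -/
theorem prod_one_sub_apply_mul (u : (ZMod m)ˣ) (T : ℂ) :
    ∏ χ : DirichletCharacter ℂ m, (1 - χ u * T) =
      (1 - T ^ orderOf u) ^ (m.totient / orderOf u) := by
  classical
  set f := orderOf u with hf
  have hf0 : 0 < f := orderOf_pos u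
  set c := #{χ : DirichletCharacter ℂ m | χ u = 1} with hc
  have hcf : c * f = m.totient := card_filter_apply_eq_one_mul_orderOf u
  have hc' : m.totient / f = c := Nat.div_eq_of_eq_mul_left hf0 hcf.symm
  rw [hc']
  set φ := evalUnitHom u with hφ
  have h1 : ∏ χ : DirichletCharacter ℂ m, (1 - χ u * T) =
      ∏ χ : DirichletCharacter ℂ m, (fun x : ℂˣ ↦ 1 - (x : ℂ) * T) (φ χ) := by
    refine Finset.prod_congr rfl fun χ _ ↦ ?_
    simp only [hφ, coe_evalUnitHom]
  rw [h1, Finset.prod_comp (f := fun x : ℂˣ ↦ 1 - (x : ℂ) * T) (g := φ)]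
  have hfib : ∀ x ∈ univ.image φ,
      #{χ ∈ (univ : Finset (DirichletCharacter ℂ m)) | φ χ = x} = c := by
    intro x hx
    have hx' : x ∈ Set.range φ := by
      obtain ⟨χ, -, rfl⟩ := Finset.mem_image.mp hx
      exact ⟨χ, rfl⟩
    have h1' : (1 : ℂˣ) ∈ Set.range φ := ⟨1, map_one φ⟩
    rw [MonoidHom.card_fiber_eq_of_mem_range φ hx' h1', hc]
    congr 1
    ext χ
    simp only [mem_filter, mem_univ, true_and, hφ, evalUnitHom_eq_one_iff]
  rw [Finset.prod_congr rfl fun x hx ↦ by rw [hfib x hx], Finset.prod_pow]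
  congr 1
  -- the image of `φ` is the set of `f`-th roots of unity: count fibres
  have hcpos : 0 < c := by
    rw [hc]
    exact Finset.card_pos.mpr ⟨1, by simp⟩
  have hcard_img : (univ.image φ).card = f := by
    have htot : #(univ : Finset (DirichletCharacter ℂ m)) = (univ.image φ).card * c := by
      rw [Finset.card_eq_sum_card_image φ univ, Finset.sum_congr rfl hfib, sum_const,
        smul_eq_mul]
    have huniv : #(univ : Finset (DirichletCharacter ℂ m)) = m.totient := by
      rw [Finset.card_univ, ← Nat.card_eq_fintype_card,
        card_eq_totient_of_hasEnoughRootsOfUnity ℂ m]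
    have : (univ.image φ).card * c = f * c := by rw [← htot, huniv, ← hcf, mul_comm]
    exact Nat.eq_of_mul_eq_mul_right hcpos this
  have hsub :
      (univ.image φ).image (Units.val : ℂˣ → ℂ) ⊆ Polynomial.nthRootsFinset f (1 : ℂ) := by
    intro z hz
    obtain ⟨x, hx, rfl⟩ := Finset.mem_image.mp hz
    obtain ⟨χ, -, rfl⟩ := Finset.mem_image.mp hx
    rw [Polynomial.mem_nthRootsFinset hf0, hφ, coe_evalUnitHom, ← map_pow,
      ← Units.val_pow_eq_pow_val, hf, pow_orderOf_eq_one, Units.val_one, map_one]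
  have heq :
      (univ.image φ).image (Units.val : ℂˣ → ℂ) = Polynomial.nthRootsFinset f (1 : ℂ) := by
    refine Finset.eq_of_subset_of_card_le hsub ?_
    rw [(Complex.isPrimitiveRoot_exp f hf0.ne').card_nthRootsFinset,
      Finset.card_image_of_injective _ Units.val_injective, hcard_img]
  rw [← Finset.prod_image (s := univ.image φ) (g := (Units.val : ℂˣ → ℂ))
    (f := fun z : ℂ ↦ 1 - z * T) Units.val_injective.injOn, heq,
    ← (Complex.isPrimitiveRoot_exp f hf0.ne').pow_sub_pow_eq_prod_sub_mul 1 T hf0, one_pow]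

/-! ## 2. The character side of the Euler factor at `p` -/

variable {N : ℕ} [NeZero N]

/-- Reduction of a product over the characters `χ` mod `N` of a function of `χ⋆(p)` (`χ⋆` the
primitive character inducing `χ`, `p` prime) to the characters mod the prime-to-`p` part
`m = N / p^{v_p(N)}` of `N`: `χ⋆(p) ≠ 0` iff `p ∤ cond(χ)` iff `cond(χ) ∣ m` iff `χ` is the lift
of a character `ψ` mod `m`, and then `χ⋆(p) = ψ⋆(p) = ψ(p)`. (Fröhlich–Taylor, *Algebraic
Number Theory*, VI §2 (2.12)(a) "`ψ` is non-ramified at `p` iff `χ̃(p) ≠ 0`" and proof of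
Thm. 47: the characters non-ramified at `p` "form a subgroup of `Ψ_K`, the image of `j_M^K`,
where `M = K^Σ`", `fg` in number; Washington, Ch. 3 and proof of Thm. 4.3.)
[cite: FrohlichTaylor1990, Ch. VI §2, (2.12)(a) and Theorem 47 (proof)] -/
theorem prod_primitiveCharacter_apply_prime_eq {p : ℕ} (hp : p.Prime) (g : ℂ → ℂ)
    (hg : g 0 = 1) :
    ∏ χ : DirichletCharacter ℂ N, g (χ.primitiveCharacter (p : ZMod χ.conductor)) =
      ∏ ψ : DirichletCharacter ℂ (N / p ^ N.factorization p),
        g (ψ (p : ZMod (N / p ^ N.factorization p))) := by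
  classical
  set m := N / p ^ N.factorization p with hm
  have hmN : m ∣ N := Nat.ordCompl_dvd N p
  haveI : NeZero m := ⟨(Nat.ordCompl_pos p (NeZero.ne N)).ne'⟩
  have hcop : p.Coprime m := Nat.coprime_ordCompl hp (NeZero.ne N)
  have hcopZ : IsCoprime (p : ℤ) (m : ℤ) := Nat.isCoprime_iff_coprime.mpr hcop
  have hι : Function.Injective (changeLevel (R := ℂ) hmN) := changeLevel_injective hmN
  rw [← Finset.prod_subset (Finset.subset_univ (Finset.univ.image (changeLevel (R := ℂ) hmN)))
      ?_, Finset.prod_image hι.injOn]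
  · refine Finset.prod_congr rfl fun ψ _ ↦ ?_
    have h1 := primitiveCharacter_changeLevel_apply (R := ℂ) hmN ψ p
    have h2 := primitiveCharacter_apply_of_isCoprime ψ hcopZ
    simp only [Int.cast_natCast] at h1 h2
    rw [h1, h2]
  · intro χ _ hχ
    suffices h : χ.primitiveCharacter (p : ZMod χ.conductor) = 0 by rw [h, hg]
    by_contra h
    apply hχ
    have h' : IsCoprime (p : ℤ) χ.conductor := by
      rw [← apply_ne_zero_iff χ.primitiveCharacter, Int.cast_natCast]
      exact h
    have hpd : ¬ p ∣ χ.conductor := by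
      rw [← hp.coprime_iff_not_dvd, ← Nat.isCoprime_iff_coprime]
      exact h'
    have hdvd : χ.conductor ∣ m := Nat.dvd_ordCompl_of_dvd_not_dvd χ.conductor_dvd_level hpd
    refine Finset.mem_image.mpr ⟨changeLevel hdvd χ.primitiveCharacter, Finset.mem_univ _, ?_⟩
    rw [← changeLevel_trans, changeLevel_primitiveCharacter]

/-- The order of the prime `p` modulo the prime-to-`p` part of `N` is positive. [folklore] -/
lemma orderOf_cast_ordCompl_pos {p : ℕ} (hp : p.Prime) :
    0 < orderOf (p : ZMod (N / p ^ N.factorization p)) := by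
  haveI : NeZero (N / p ^ N.factorization p) := ⟨(Nat.ordCompl_pos p (NeZero.ne N)).ne'⟩
  have hcop : p.Coprime (N / p ^ N.factorization p) := Nat.coprime_ordCompl hp (NeZero.ne N)
  rw [← ZMod.coe_unitOfCoprime p hcop, orderOf_units]
  exact orderOf_pos _

/-- **Character side of the Euler factor at `p`** of `∏_{χ mod N} L(s, χ⋆)`: with
`m = N / p^{v_p(N)}` and `f` the order of `p` mod `m`,
`∏_{χ mod N} (1 - χ⋆(p) T)⁻¹ = ((1 - T^f)^{φ(m)/f})⁻¹`
(`prod_primitiveCharacter_apply_prime_eq` and the character product lemma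
`prod_one_sub_apply_mul`). This is Fröhlich–Taylor, Thm. 47 —
`∏_{ν ∈ Θ̃_K} (T − ν(p)) = T^{fg(e−1)} (T^f − 1)^g` for `K = ℚ[N]` — multiplied through by
`T^{-efg}` at `T⁻¹` (as in the proof of Thm. 65, eq. (3.4)), with `f`, `g` expressed by (1.15).
[cite: FrohlichTaylor1990, Ch. VI §2, Theorem 47] -/
theorem prod_inv_one_sub_primitiveCharacter_mul {p : ℕ} (hp : p.Prime) (T : ℂ) :
    ∏ χ : DirichletCharacter ℂ N,
        (1 - χ.primitiveCharacter (p : ZMod χ.conductor) * T)⁻¹ =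
      ((1 - T ^ orderOf (p : ZMod (N / p ^ N.factorization p))) ^
        ((N / p ^ N.factorization p).totient /
          orderOf (p : ZMod (N / p ^ N.factorization p))))⁻¹ := by
  rw [prod_primitiveCharacter_apply_prime_eq hp (fun z ↦ (1 - z * T)⁻¹) (by simp),
    Finset.prod_inv_distrib]
  congr 1
  set m := N / p ^ N.factorization p with hm
  haveI : NeZero m := ⟨(Nat.ordCompl_pos p (NeZero.ne N)).ne'⟩
  have hcop : p.Coprime m := Nat.coprime_ordCompl hp (NeZero.ne N)
  rw [show (p : ZMod m) = ((ZMod.unitOfCoprime p hcop : (ZMod m)ˣ) : ZMod m) from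
    (ZMod.coe_unitOfCoprime p hcop).symm, orderOf_units]
  exact prod_one_sub_apply_mul _ T

end DirichletCharacter

/-! ## 3. The Dedekind side of the Euler factor at `p` -/

namespace Literature.NumberTheory.LFunctions

section PrimeBelow

variable {K : Type*} [Field K]

/-- The rational prime below a nonzero prime `v` of `𝓞 K`: the positive generator of the prime
ideal `v ∩ ℤ` of `ℤ`. [folklore] -/
def natPrimeBelow (v : HeightOneSpectrum (𝓞 K)) : ℕ :=
  absNorm (v.asIdeal.under ℤ)

/-- `(natPrimeBelow v) = v ∩ ℤ` as ideals of `ℤ`. [folklore] -/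
theorem span_natPrimeBelow (v : HeightOneSpectrum (𝓞 K)) :
    span {(natPrimeBelow v : ℤ)} = v.asIdeal.under ℤ :=
  Int.ideal_span_absNorm_eq_self _

/-- `v ∩ ℤ ≠ 0` for a nonzero prime `v` of `𝓞 K` (`𝓞 K` is integral over `ℤ`).
[folklore] -/
theorem under_int_ne_bot (v : HeightOneSpectrum (𝓞 K)) : v.asIdeal.under ℤ ≠ ⊥ :=
  (HeightOneSpectrum.under ℤ v).ne_bot

/-- The prime below `v` is a prime number. [folklore] -/
theorem natPrimeBelow_prime (v : HeightOneSpectrum (𝓞 K)) : (natPrimeBelow v).Prime := by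
  have hne : (natPrimeBelow v : ℤ) ≠ 0 := by
    intro h
    apply under_int_ne_bot v
    rw [← span_natPrimeBelow, Ideal.span_singleton_eq_bot]
    exact h
  have hprime : (span {(natPrimeBelow v : ℤ)}).IsPrime := by
    rw [span_natPrimeBelow]
    infer_instance
  exact Nat.prime_iff_prime_int.mpr ((Ideal.span_singleton_prime hne).mp hprime)

/-- `v` lies over the rational prime `p` iff `p` is the prime below `v`. [folklore] -/
theorem liesOver_span_iff_natPrimeBelow_eq (v : HeightOneSpectrum (𝓞 K)) (p : ℕ) :
    v.asIdeal.LiesOver (span {(p : ℤ)}) ↔ natPrimeBelow v = p := by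
  rw [Ideal.liesOver_iff, Ideal.under_def, ← Ideal.under_def, ← span_natPrimeBelow,
    Ideal.span_singleton_eq_span_singleton, Int.associated_iff_natAbs, Int.natAbs_natCast,
    Int.natAbs_natCast, eq_comm]

/-- The rational prime below `v`, as an element of `Nat.Primes`. [folklore] -/
def primeBelow (v : HeightOneSpectrum (𝓞 K)) : Nat.Primes :=
  ⟨natPrimeBelow v, natPrimeBelow_prime v⟩

variable [NumberField K]

/-- The nonzero primes of `𝓞 K` above the rational prime `p` (the fibre of `primeBelow` over
`p`) are in bijection with Mathlib's `primesOver (p) (𝓞 K)`. [folklore] -/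
def fiberPrimeBelowEquiv (p : Nat.Primes) :
    {v : HeightOneSpectrum (𝓞 K) // primeBelow v = p} ≃
      (span {((p : ℕ) : ℤ)}).primesOver (𝓞 K) where
  toFun v := ⟨v.1.asIdeal, v.1.isPrime,
    (liesOver_span_iff_natPrimeBelow_eq v.1 p).mpr (congrArg Subtype.val v.2)⟩
  invFun Q := ⟨⟨Q.1, Q.2.1, by
      haveI := Q.2.2
      exact Ideal.ne_bot_of_liesOver_of_ne_bot (p := span {((p : ℕ) : ℤ)})
        (by simpa using p.2.ne_zero) Q.1⟩,
    Subtype.ext ((liesOver_span_iff_natPrimeBelow_eq _ p).mp Q.2.2)⟩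
  left_inv v := rfl
  right_inv Q := rfl

/-- The fibre of `primeBelow` over `p` is finite (finitely many primes above `p`). [folklore] -/
instance fintypeFiberPrimeBelow (p : Nat.Primes) :
    Fintype {v : HeightOneSpectrum (𝓞 K) // primeBelow v = p} :=
  haveI : Fact (p : ℕ).Prime := ⟨p.2⟩
  Fintype.ofEquiv _ (fiberPrimeBelowEquiv p).symm

/-- The number of nonzero primes of `𝓞 K` above `p` is `#primesOver (p)`. [folklore] -/
theorem card_fiberPrimeBelow (p : Nat.Primes) :
    haveI : Fact (p : ℕ).Prime := ⟨p.2⟩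
    Fintype.card {v : HeightOneSpectrum (𝓞 K) // primeBelow v = p} =
      ((span {((p : ℕ) : ℤ)}).primesOver (𝓞 K)).ncard := by
  haveI : Fact (p : ℕ).Prime := ⟨p.2⟩
  rw [← Nat.card_eq_fintype_card, Nat.card_congr (fiberPrimeBelowEquiv p), Nat.card_coe_set_eq]

omit [NumberField K] in
/-- A prime in the fibre of `primeBelow` over `p` lies over `(p) ⊆ ℤ` (used as a local instance
below). [folklore] -/
theorem liesOver_of_primeBelow_eq {p : Nat.Primes}
    (v : {v : HeightOneSpectrum (𝓞 K) // primeBelow v = p}) :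
    v.1.asIdeal.LiesOver (span {((p : ℕ) : ℤ)}) :=
  (liesOver_span_iff_natPrimeBelow_eq v.1 p).mpr (congrArg Subtype.val v.2)

omit [NumberField K] in
/-- Primes of the height-one spectrum are prime ideals (form used as a local instance for fibre
elements below). [folklore] -/
theorem isPrime_of_primeBelow_eq {p : Nat.Primes}
    (v : {v : HeightOneSpectrum (𝓞 K) // primeBelow v = p}) : v.1.asIdeal.IsPrime :=
  v.1.isPrime

attribute [local instance] liesOver_of_primeBelow_eq isPrime_of_primeBelow_eq

/-- `N(v) = p ^ f(v|p)` for a prime `v` of `𝓞 K` above `p` (definition of the residue class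
degree; Mathlib `Ideal.pow_inertiaDeg`). [folklore] -/
theorem absNorm_eq_pow_inertiaDeg {p : Nat.Primes}
    (v : {v : HeightOneSpectrum (𝓞 K) // primeBelow v = p}) :
    absNorm v.1.asIdeal = (p : ℕ) ^ v.1.asIdeal.inertiaDeg ℤ :=
  (Ideal.pow_inertiaDeg (p : ℕ) v.1.asIdeal).symm

end PrimeBelow

section Cyclotomic

variable (N : ℕ) [NeZero N] {K : Type*} [Field K] [NumberField K]
  [hK : IsCyclotomicExtension {N} ℚ K]

attribute [local instance] liesOver_of_primeBelow_eq isPrime_of_primeBelow_eq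

include hK in
/-- **Decomposition of primes in `ℚ(ζ_N)`, residue degree**: write `N = p^a m` with `p ∤ m`;
every prime of `ℚ(ζ_N)` above `p` has residue degree `f =` the order of `p` mod `m`
(Mathlib `IsCyclotomicExtension.Rat.inertiaDeg_eq`, `inertiaDeg_eq_of_not_dvd`; Fröhlich–Taylor
VI §1 (1.12): "`f_p` … is the order of `p mod (m)`" for `p ∤ m`, and (1.15):
"`f_p(ℚ[m]/ℚ)` is the order of `p mod (n)`" for `m = n p^r`).
[cite: FrohlichTaylor1990, Ch. VI §1, (1.12) and (1.15)] -/
theorem inertiaDeg_eq_orderOf_cyclotomic {p : Nat.Primes}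
    (v : {v : HeightOneSpectrum (𝓞 K) // primeBelow v = p}) :
    v.1.asIdeal.inertiaDeg ℤ =
      orderOf ((p : ℕ) : ZMod (N / (p : ℕ) ^ N.factorization p)) := by
  haveI : Fact (p : ℕ).Prime := ⟨p.2⟩
  set m := N / (p : ℕ) ^ N.factorization p with hm
  have hcop : (p : ℕ).Coprime m := Nat.coprime_ordCompl p.2 (NeZero.ne N)
  have hpm : ¬ (p : ℕ) ∣ m := (Nat.Prime.coprime_iff_not_dvd p.2).mp hcop
  have hN : N = (p : ℕ) ^ N.factorization p * m :=
    (Nat.ordProj_mul_ordCompl_eq_self N p).symm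
  rcases Nat.eq_zero_or_pos (N.factorization p) with h0 | hpos
  · have hmN : m = N := by rw [hm, h0, pow_zero, Nat.div_one]
    haveI : NeZero m := ⟨hmN ▸ NeZero.ne N⟩
    haveI : IsCyclotomicExtension {m} ℚ K := hmN ▸ hK
    exact IsCyclotomicExtension.Rat.inertiaDeg_eq_of_not_dvd p K v.1.asIdeal hpm
  · obtain ⟨k, hk⟩ := Nat.exists_eq_add_one_of_ne_zero hpos.ne'
    rw [hk] at hN
    exact IsCyclotomicExtension.Rat.inertiaDeg_eq N K v.1.asIdeal hN hpm

include hK in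
/-- **Decomposition of primes in `ℚ(ζ_N)`, `f · g = φ(m)`**: write `N = p^a m` with `p ∤ m`, let
`g` be the number of primes of `ℚ(ζ_N)` above `p` and `f` the order of `p` mod `m`; then
`g · f = φ(m)` — from the fundamental identity `e f g = [ℚ(ζ_N) : ℚ] = φ(N)` (Mathlib
`Ideal.ncard_primesOver_mul_ramificationIdxIn_mul_inertiaDegIn`) and `e = φ(p^a)` (Mathlib
`IsCyclotomicExtension.Rat.ramificationIdx_eq`; Fröhlich–Taylor VI §1 (1.15):
"`e_p(ℚ[m]/ℚ) = φ(p^r)`", and Thm. 47: "`efg = (K : ℚ)`").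
[cite: FrohlichTaylor1990, Ch. VI §1, (1.15)] -/
theorem card_fiber_mul_orderOf_cyclotomic (p : Nat.Primes) :
    Fintype.card {v : HeightOneSpectrum (𝓞 K) // primeBelow v = p} *
        orderOf ((p : ℕ) : ZMod (N / (p : ℕ) ^ N.factorization p)) =
      (N / (p : ℕ) ^ N.factorization p).totient := by
  haveI : Fact (p : ℕ).Prime := ⟨p.2⟩
  haveI : IsGalois ℚ K := IsCyclotomicExtension.isGalois {N} ℚ K
  set m := N / (p : ℕ) ^ N.factorization p with hm
  have hcop : (p : ℕ).Coprime m := Nat.coprime_ordCompl p.2 (NeZero.ne N)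
  have hpm : ¬ (p : ℕ) ∣ m := (Nat.Prime.coprime_iff_not_dvd p.2).mp hcop
  have hN : N = (p : ℕ) ^ N.factorization p * m :=
    (Nat.ordProj_mul_ordCompl_eq_self N p).symm
  obtain ⟨⟨P, hP1, hP2⟩⟩ := (span {((p : ℕ) : ℤ)}).nonempty_primesOver (S := 𝓞 K)
  have hmain := Ideal.ncard_primesOver_mul_ramificationIdxIn_mul_inertiaDegIn
    (span {((p : ℕ) : ℤ)}) (𝓞 K) Gal(K/ℚ)
  rw [IsGaloisGroup.card_eq_finrank Gal(K/ℚ) ℚ K, IsCyclotomicExtension.Rat.finrank N K,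
    Ideal.inertiaDegIn_eq_inertiaDeg (span {((p : ℕ) : ℤ)}) P Gal(K/ℚ),
    Ideal.ramificationIdxIn_eq_ramificationIdx (span {((p : ℕ) : ℤ)}) P Gal(K/ℚ)] at hmain
  rw [card_fiberPrimeBelow]
  have hf : P.inertiaDeg ℤ = orderOf ((p : ℕ) : ZMod m) :=
    inertiaDeg_eq_orderOf_cyclotomic N ⟨⟨P, hP1, Ideal.ne_bot_of_liesOver_of_ne_bot
      (p := span {((p : ℕ) : ℤ)}) (by simpa using p.2.ne_zero) P⟩,
      Subtype.ext ((liesOver_span_iff_natPrimeBelow_eq _ p).mp hP2)⟩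
  rcases Nat.eq_zero_or_pos (N.factorization p) with h0 | hpos
  · have hmN : m = N := by rw [hm, h0, pow_zero, Nat.div_one]
    haveI : NeZero m := ⟨hmN ▸ NeZero.ne N⟩
    haveI : IsCyclotomicExtension {m} ℚ K := hmN ▸ hK
    have he : P.ramificationIdx ℤ = 1 :=
      IsCyclotomicExtension.Rat.ramificationIdx_eq_of_not_dvd p K P hpm
    rw [he, hf, one_mul] at hmain
    rw [hmain, hmN]
  · obtain ⟨k, hk⟩ := Nat.exists_eq_add_one_of_ne_zero hpos.ne'
    rw [hk] at hN
    have he : P.ramificationIdx ℤ = (p : ℕ) ^ k * ((p : ℕ) - 1) :=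
      IsCyclotomicExtension.Rat.ramificationIdx_eq N K P hN hpm
    rw [he, hf, ← Nat.totient_prime_pow_succ p.2] at hmain
    have htot : N.totient = ((p : ℕ) ^ (k + 1)).totient * m.totient := by
      conv_lhs => rw [hN]
      exact Nat.totient_mul ((Nat.Coprime.pow_left (k + 1) hcop))
    rw [htot] at hmain
    have hne : ((p : ℕ) ^ (k + 1)).totient ≠ 0 :=
      (Nat.totient_pos.mpr (pow_pos p.2.pos _)).ne'
    have : ((p : ℕ) ^ (k + 1)).totient *
        ((((span {((p : ℕ) : ℤ)}).primesOver (𝓞 K)).ncard) * orderOf ((p : ℕ) : ZMod m)) =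
        ((p : ℕ) ^ (k + 1)).totient * m.totient := by
      rw [← hmain]; ring
    exact Nat.eq_of_mul_eq_mul_left (Nat.pos_of_ne_zero hne) this

include hK in
/-- **Dedekind side of the Euler factor at `p`** for `K = ℚ(ζ_N)`:
`∏_{v | p} (1 - N(v)^{-s})⁻¹ = ((1 - (p^{-s})^f)⁻¹)^g` with `f`, `g` as above
(Fröhlich–Taylor VIII §3, eq. (3.4), right-hand side). [folklore] -/
theorem prod_fiber_dedekindEulerFactor (p : Nat.Primes) (s : ℂ) :
    ∏ v : {v : HeightOneSpectrum (𝓞 K) // primeBelow v = p}, dedekindEulerFactor K v.1 s =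
      ((1 - (((p : ℕ) : ℂ) ^ (-s)) ^
          orderOf ((p : ℕ) : ZMod (N / (p : ℕ) ^ N.factorization p)))⁻¹) ^
        Fintype.card {v : HeightOneSpectrum (𝓞 K) // primeBelow v = p} := by
  rw [← Finset.card_univ, ← Finset.prod_const]
  refine Finset.prod_congr rfl fun v _ ↦ ?_
  rw [dedekindEulerFactor, absNorm_eq_pow_inertiaDeg v, inertiaDeg_eq_orderOf_cyclotomic N v,
    Nat.cast_pow, ← Complex.natCast_cpow_natCast_mul, Complex.cpow_nat_mul]

/-! ## 4. The Euler factors agree; the factorisation on `re s > 1` -/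

include hK in
/-- **Euler factors at `p` of `ζ_{ℚ(ζ_N)}` and of `∏_{χ mod N} L(s, χ⋆)` agree**:
`∏_{v | p} (1 - N(v)^{-s})⁻¹ = ∏_{χ mod N} (1 - χ⋆(p) p^{-s})⁻¹` — both equal
`(1 - p^{-fs})^{-g}` (`prod_fiber_dedekindEulerFactor`, `card_fiber_mul_orderOf_cyclotomic`,
`DirichletCharacter.prod_inv_one_sub_primitiveCharacter_mul`). (Fröhlich–Taylor, *Algebraic
Number Theory*, VIII §3, eq. (3.4), from Thm. 47; Washington, proof of Thm. 4.3.)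
[cite: FrohlichTaylor1990, Ch. VIII §3, (3.4)] -/
theorem prod_fiber_dedekindEulerFactor_eq_prod_character (p : Nat.Primes) (s : ℂ) :
    ∏ v : {v : HeightOneSpectrum (𝓞 K) // primeBelow v = p}, dedekindEulerFactor K v.1 s =
      ∏ χ : DirichletCharacter ℂ N,
        (1 - χ.primitiveCharacter ((p : ℕ) : ZMod χ.conductor) *
          ((p : ℕ) : ℂ) ^ (-s))⁻¹ := by
  rw [prod_fiber_dedekindEulerFactor N p s,
    DirichletCharacter.prod_inv_one_sub_primitiveCharacter_mul p.2, inv_pow]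
  congr 2
  exact (Nat.div_eq_of_eq_mul_left (DirichletCharacter.orderOf_cast_ordCompl_pos p.2)
    (card_fiber_mul_orderOf_cyclotomic (K := K) N p).symm).symm

variable (K)

include hK in
/-- **The Dedekind zeta function of `ℚ(ζ_N)` is the product of the Dirichlet `L`-series of the
primitive characters inducing the characters mod `N`**: for `re s > 1`,
`ζ_K(s) = ∏_{χ mod N} L(s, χ⋆)` for every `N`-th cyclotomic extension `K` of `ℚ`. Both sides
are convergent Euler products (`Literature.NumberTheory.LFunctions.hasProd_dedekindEulerFactor_holds`, Neukirch VII (5.2); Mathlib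
`DirichletCharacter.LSeries_eulerProduct_hasProd`) whose factors at each prime `p` agree
(`prod_fiber_dedekindEulerFactor_eq_prod_character`), the Dedekind product being regrouped
along the primes below (`HasProd.sigma`). (Fröhlich–Taylor, *Algebraic Number Theory*, VIII §3,
Theorem 65 (a): `∏_{χ ∈ Θ̃_K} L(x, χ) = ζ_K(x)` for `x > 1`; Washington, *Introduction to
Cyclotomic Fields*, Thm. 4.3.) [cite: FrohlichTaylor1990, Ch. VIII §3, Theorem 65(a)]
[cite: Washington1997, Thm. 4.3] -/
theorem dedekindZeta_eq_prod_LSeries_primitiveCharacter {s : ℂ} (hs : 1 < s.re) :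
    dedekindZeta K s =
      ∏ χ : DirichletCharacter ℂ N,
        LSeries (fun n ↦ χ.primitiveCharacter (n : ZMod χ.conductor)) s := by
  -- Dedekind side, regrouped along `primeBelow`
  have hD := hasProd_dedekindEulerFactor_holds K hs
  have hD' := (Equiv.hasProd_iff (Equiv.sigmaFiberEquiv (primeBelow (K := K)))).mpr hD
  have hD'' : HasProd (fun p : Nat.Primes ↦
      ∏ v : {v : HeightOneSpectrum (𝓞 K) // primeBelow v = p}, dedekindEulerFactor K v.1 s)
      (dedekindZeta K s) := by
    refine hD'.sigma fun p ↦ ?_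
    simpa only [Function.comp_def, Equiv.sigmaFiberEquiv_apply] using
      hasProd_fintype (fun v : {v : HeightOneSpectrum (𝓞 K) // primeBelow v = p} ↦
        dedekindEulerFactor K v.1 s)
  -- character side
  have hC : HasProd (fun p : Nat.Primes ↦ ∏ χ : DirichletCharacter ℂ N,
      (1 - χ.primitiveCharacter ((p : ℕ) : ZMod χ.conductor) *
        ((p : ℕ) : ℂ) ^ (-s))⁻¹)
      (∏ χ : DirichletCharacter ℂ N,
        LSeries (fun n ↦ χ.primitiveCharacter (n : ZMod χ.conductor)) s) :=
    hasProd_prod fun χ _ ↦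
      DirichletCharacter.LSeries_eulerProduct_hasProd χ.primitiveCharacter hs
  have heq : (fun p : Nat.Primes ↦
      ∏ v : {v : HeightOneSpectrum (𝓞 K) // primeBelow v = p}, dedekindEulerFactor K v.1 s) =
      fun p : Nat.Primes ↦ ∏ χ : DirichletCharacter ℂ N,
        (1 - χ.primitiveCharacter ((p : ℕ) : ZMod χ.conductor) *
          ((p : ℕ) : ℂ) ^ (-s))⁻¹ := by
    funext p
    exact prod_fiber_dedekindEulerFactor_eq_prod_character N p s
  rw [heq] at hD''
  exact hD''.unique hC

/-! ## 5. The continuation of `ζ_{ℚ(ζ_N)}` -/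

variable {K}

/-- The product of the (continued) Dirichlet `L`-functions of the primitive characters inducing
the characters mod `N`: `s ↦ ∏_{χ mod N} L(s, χ⋆)` (Mathlib `DirichletCharacter.LFunction`).
By `dedekindZetaCont_eq_cyclotomicLProduct` it is the continued Dedekind zeta function of
`ℚ(ζ_N)` off `s = 1` (Washington, Thm. 4.3; Fröhlich–Taylor Thm. 65 (a) with Thm. 64,
Remark 3). [cite: Washington1997, Thm. 4.3] -/
def cyclotomicLProduct (N : ℕ) [NeZero N] (s : ℂ) : ℂ :=
  ∏ χ : DirichletCharacter ℂ N,
    (haveI : NeZero χ.conductor := ⟨χ.conductor_ne_zero⟩; χ.primitiveCharacter.LFunction s)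

omit hK in
/-- `cyclotomicLProduct N` is holomorphic off `s = 1` (each `L(s, χ⋆)` is, Mathlib
`DirichletCharacter.differentiableAt_LFunction`). [folklore] -/
theorem differentiableAt_cyclotomicLProduct {s : ℂ} (hs : s ≠ 1) :
    DifferentiableAt ℂ (cyclotomicLProduct N) s := by
  unfold cyclotomicLProduct
  refine DifferentiableAt.fun_finsetProd fun χ _ ↦ ?_
  haveI : NeZero χ.conductor := ⟨χ.conductor_ne_zero⟩
  exact DirichletCharacter.differentiableAt_LFunction _ s (Or.inl hs)

variable (K)

include hK in
/-- For `re s > 1`, `∏_{χ mod N} L(s, χ⋆) = ζ_K(s)` with Mathlib's continued `L`-functions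
(`DirichletCharacter.LFunction_eq_LSeries` and
`dedekindZeta_eq_prod_LSeries_primitiveCharacter`). (Fröhlich–Taylor Thm. 65 (a); Washington
Thm. 4.3.) [cite: FrohlichTaylor1990, Ch. VIII §3, Theorem 65(a)] -/
theorem cyclotomicLProduct_eq_dedekindZeta {s : ℂ} (hs : 1 < s.re) :
    cyclotomicLProduct N s = dedekindZeta K s := by
  rw [dedekindZeta_eq_prod_LSeries_primitiveCharacter N K hs, cyclotomicLProduct]
  refine Finset.prod_congr rfl fun χ _ ↦ ?_
  haveI : NeZero χ.conductor := ⟨χ.conductor_ne_zero⟩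
  exact DirichletCharacter.LFunction_eq_LSeries _ hs

include hK in
/-- `∏_{χ mod N} L(s, χ⋆)` is a continuation of `ζ_K` to `ℂ ∖ {1}` for every `N`-th cyclotomic
extension `K/ℚ` (`IsDedekindZetaContinuation`): holomorphic off `s = 1` and equal to the
Dirichlet series on `re s > 1`. (Washington, Thm. 4.3; Fröhlich–Taylor Thm. 65 (a).)
[cite: Washington1997, Thm. 4.3] -/
theorem isDedekindZetaContinuation_cyclotomicLProduct :
    IsDedekindZetaContinuation K (cyclotomicLProduct N) where
  differentiableOn := fun _ hs ↦
    (differentiableAt_cyclotomicLProduct N hs).differentiableWithinAt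
  eqOn := fun _ hs ↦ cyclotomicLProduct_eq_dedekindZeta N K hs

include hK in
/-- **Hecke's theorem for cyclotomic fields, proved**: the named fact
`Literature.exists_isDedekindZetaContinuation K` holds for every `N`-th cyclotomic extension `K/ℚ`,
the continuation being `∏_{χ mod N} L(s, χ⋆)`. (Washington, Thm. 4.3; Neukirch VII (5.10) in
general.) [cite: Washington1997, Thm. 4.3] -/
theorem exists_isDedekindZetaContinuation_of_isCyclotomicExtension :
    exists_isDedekindZetaContinuation K :=
  ⟨_, isDedekindZetaContinuation_cyclotomicLProduct N K⟩

include hK in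
/-- **`ζ_K(s) = ∏_{χ mod N} L(s, χ⋆)` for all `s ≠ 1`**, `K` any `N`-th cyclotomic extension
of `ℚ` and `ζ_K = dedekindZetaCont K` the continued Dedekind zeta function (uniqueness of the
continuation, `IsDedekindZetaContinuation.eqOn_dedekindZetaCont_holds`). (Washington,
*Introduction to Cyclotomic Fields*, Thm. 4.3; Fröhlich–Taylor Thm. 65 (a).)
[cite: Washington1997, Thm. 4.3] -/
theorem dedekindZetaCont_eq_cyclotomicLProduct {s : ℂ} (hs : s ≠ 1) :
    dedekindZetaCont K s = cyclotomicLProduct N s :=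
  (IsDedekindZetaContinuation.eqOn_dedekindZetaCont_holds
    (isDedekindZetaContinuation_cyclotomicLProduct N K) hs).symm

include hK in
/-- A zero of some `L(s, χ)`, `χ` mod `N`, with `re s > 0` and `s ≠ 1` is a zero of the
continued Dedekind zeta function of any `N`-th cyclotomic extension `K/ℚ`: `L(s, χ) = 0` forces
`L(s, χ⋆) = 0` (the missing Euler factors do not vanish for `re s > 0`,
`DirichletCharacter.LFunction_eq_zero_iff_primitiveCharacter`), a factor of
`ζ_K(s) = ∏_{χ' mod N} L(s, χ'⋆)`. (Davenport, *Multiplicative Number Theory*, ch. 5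
(2)–(3); Washington Thm. 4.3.) [cite: Washington1997, Thm. 4.3] -/
theorem dedekindZetaCont_eq_zero_of_LFunction_eq_zero (χ : DirichletCharacter ℂ N) {s : ℂ}
    (hs : χ.LFunction s = 0) (h0 : 0 < s.re) (hs1 : s ≠ 1) : dedekindZetaCont K s = 0 := by
  rw [dedekindZetaCont_eq_cyclotomicLProduct N K hs1, cyclotomicLProduct]
  exact Finset.prod_eq_zero (Finset.mem_univ χ)
    ((χ.LFunction_eq_zero_iff_primitiveCharacter h0 hs1).mp hs)

end Cyclotomic

/-! ## 6. ERH implies GRH, and conversely for cyclotomic fields -/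

section GRH

/-- **Discharge of `ExtendedRiemannHypothesis.generalizedRiemannHypothesis`: ERH implies GRH for
Dirichlet `L`-functions.** Given ERH and a zero `s` of `L(s, χ)` (`χ` mod `N`) in the open
critical strip, `s` is a zero of the continued Dedekind zeta function of the cyclotomic field
`CyclotomicField N ℚ` (`dedekindZetaCont_eq_zero_of_LFunction_eq_zero`, from
`ζ_{ℚ(ζ_N)}(s) = ∏_{χ' mod N} L(s, χ'⋆)`, Washington Thm. 4.3, and `L(s, χ) = 0 → L(s, χ⋆) = 0`
for `re s > 0`, `s ≠ 1`), so ERH for that field gives `re s = 1/2`. (Washington, *Introduction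
to Cyclotomic Fields*, Thm. 4.3; Davenport, *Multiplicative Number Theory*, ch. 20.)
[cite: Washington1997, Thm. 4.3] [cite: DavenportMNT1980, Ch. 20] -/
theorem ExtendedRiemannHypothesis.generalizedRiemannHypothesis_holds :
    ExtendedRiemannHypothesis.generalizedRiemannHypothesis := by
  intro hERH N _ χ s hs h0 h1
  haveI : IsCyclotomicExtension {N} ℚ (CyclotomicField N ℚ) :=
    CyclotomicField.isCyclotomicExtension N ℚ
  have hs1 : s ≠ 1 := fun h ↦ by simp [h] at h1
  exact hERH (CyclotomicField N ℚ) s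
    (dedekindZetaCont_eq_zero_of_LFunction_eq_zero N (CyclotomicField N ℚ) χ hs h0 hs1) h0 h1

/-- **Conversely, GRH implies ERH for cyclotomic fields**: if every Dirichlet `L`-function
satisfies the strip form of the Riemann hypothesis, then so does the continued Dedekind zeta
function of every `N`-th cyclotomic extension `K/ℚ`, since
`ζ_K(s) = ∏_{χ mod N} L(s, χ⋆)` off `s = 1` (`dedekindZetaCont_eq_cyclotomicLProduct`,
Washington Thm. 4.3): a zero of `ζ_K` in the open strip is a zero of some `L(s, χ⋆)`, `χ⋆`
primitive mod `cond χ ≠ 0`. Together with `generalizedRiemannHypothesis_holds`: GRH is ERH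
restricted to cyclotomic fields. (Washington, *Introduction to Cyclotomic Fields*, Thm. 4.3.)
[cite: Washington1997, Thm. 4.3] -/
theorem GeneralizedRiemannHypothesis.extendedRiemannHypothesis_of_isCyclotomicExtension
    (h : LFunctions.GeneralizedRiemannHypothesis) (N : ℕ) [NeZero N] (K : Type*) [Field K]
    [NumberField K] [IsCyclotomicExtension {N} ℚ K] :
    NumberField.ExtendedRiemannHypothesis K := by
  intro s hs h0 h1
  have hs1 : s ≠ 1 := fun h' ↦ by simp [h'] at h1
  rw [dedekindZetaCont_eq_cyclotomicLProduct N K hs1, cyclotomicLProduct,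
    Finset.prod_eq_zero_iff] at hs
  obtain ⟨χ, -, hχ⟩ := hs
  haveI : NeZero χ.conductor := ⟨χ.conductor_ne_zero⟩
  exact h χ.conductor χ.primitiveCharacter s hχ h0 h1

end GRH

end Literature.NumberTheory.LFunctions

end
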